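/-
Copyright (c) 2026. All rights reserved.
Released under Apache 2.0 license as described in the file LICENSE.
-/
import Literature.AlgebraicGeometry.ComplexMultiplication.HyperellipticJacobianCrossLevelOrthogonality
import Literature.AlgebraicGeometry.ComplexMultiplication.HyperellipticJacobianTwiceOddJacobian
import HarnessLib

/-!
# GGL 2024 Thm. 3.0 + Lemma 14 at a level `m = 4p`, `p ≥ 7` prime: `J_{4p} ∼ X_4 × (X_p × X_{2p}) × X_{4p}` has
# `End⁰(J_{4p}) ≅ ℚ(i) × Mat₂(ℚ(ζ_p)) × Mat₂(ℚ(ζ_{4p} − ζ_{4p}⁻¹))`, of dimension `8p − 6`, and `dim J_{4p} = 2p − 1`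

Layer `Literature/AlgebraicGeometry/ComplexMultiplication`, namespace `…ComplexMultiplication.HyperellipticJacobian`; the first
`End⁰(J_m)` at a level DIVISIBLE BY `4` in the tree, assembled from `HyperellipticJacobianCrossLevelOrthogonality` (F12:
orthogonality across parities through the reflex fields), `HyperellipticJacobianEndomorphismAlgebras` (F9: Lemma 14 —
`End⁰(X_d) = ℚ(ζ_d)` for `d` odd, `Mat₂(ℚ(ζ_m − ζ_m⁻¹))` for `4 ∣ m ≥ 8` non-exceptional, `ℚ(i)`-type fields for primitive types),
`HyperellipticJacobianTwiceOddJacobian` (F11: `A ⊕ A′ ∼ A²`, `Mat_m(End⁰ B) ≅ End⁰(B^m)`) and `HyperellipticJacobianTwiceOddLevel`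
(F7: `X_{2p} ∼ X_p`).  THEOREMS ONLY (no definition, no named fact, no `sorry`, no instance).

## The print

A. Gallese, H. Goodson, D. Lombardo, arXiv:2405.20394 [GalleseGoodsonLombardo2024] (held `paper:arxiv-2405.20394`, p0012, p0014–p0015
read first-hand): THM. 3.0 «`J_m ∼ ∏_{d ∣ m, d ≠ 1,2} X_d`», (4) «`X_{2p} ∼ X_p`», (5) «`X_{4p} ∼ Y_{4p}²` … CM by `ℚ(ζ_d − ζ_d⁻¹)`»,
«all `X_d` with odd `d` and all `Y_d` are pairwise non-isogenous»; §3.5 LEMMA 14 and the sentence after it: «this lemma, combined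
with the last statement in Thm. 3.0, yields the geometric endomorphism algebra of `J_m` for every `m`».  For `m = 4p`, `p` prime,
the divisors `d ∉ {1, 2}` are `4, p, 2p, 4p`; for `p ≥ 7` the level `4p` is not exceptional (`4p ∉ {20, 24, 60}`) and the four
orthogonality relations needed all hold: `X_4 ⟂ X_p, X_{2p}` (F12, roots of unity of order `p`), `X_p, X_{2p} ⟂ X_{4p}` (F12),
`X_4 ⟂ X_{4p}` (reflex degrees `2 ≠ p − 1`, this file).  Hence — Mumford §19 Cor. 2 «`End⁰(X) = ⊕ M_{n_i}(D_i)`» —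
`End⁰(J_{4p}) ≅ End⁰(X_4) × End⁰(X_p × X_{2p}) × End⁰(X_{4p}) ≅ ℚ(i) × Mat₂(ℚ(ζ_p)) × Mat₂(ℚ(ζ_{4p} − ζ_{4p}⁻¹))`, of dimension
`2 + 4(p−1) + 4(p−1) = 8p − 6`; `dim J_{4p} = 1 + (p−1) + (p−1) = 2p − 1 = g(C_{4p})`.  (At `p = 3` the factors `X_4`, `X_{12}` are
NOT orthogonal — F12 `exists_hom_ne_zero_four_twelve`; at `p = 5` the level `20` is exceptional.)

## The carrier

`K₄ = ℚ(ζ_4)` with a type `Φ₄` (either one; both are realised by `X_4` up to conjugation) realised by `A₄` (`X_4`); `K = ℚ(ζ_p)`, `Φ`, `A` (`X_p`); `L = ℚ(ζ_{2p})`, `Ψ`, `A₂`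
(`X_{2p}`); `K′ = ℚ(ζ_{4p})`, `Φ′`, `A′` (`X_{4p}`); `J_{4p}` is read as the biproduct over `Fin 3` of
`![A₄, ⨁_{Fin 2} ![A, A₂], A′]`.

## What is proved

`orthogonal_four_fourDvd_of_totient_ne_four` (`X_4 ⟂ Y_{d′}` whenever `φ(d′) ≠ 4`, `4 ∣ d′ ≥ 8` non-exceptional),
`orthogonal_four_fourTimesPrime`; `hom_eq_zero_blocks_fourTimesPrime` (the three blocks are pairwise orthogonal);
**`nonempty_endAlgebra_algEquiv_fourTimesPrime`** (`End⁰(J) ≃ₐ[ℚ] K₄ × (Mat₂(K) × Mat₂(ℚ(ζ_{4p} − ζ_{4p}⁻¹)))`);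
**`finrank_endAlgebra_fourTimesPrime`** (`dim_ℚ End⁰(J) = 8p − 6`, `dim J = 2p − 1`).

## Honest column ∕ NOT here

The curve and the identification of the biproduct with `J_{4p}` itself; levels `4p^k`, `8p`, composite `4n`; `p = 3` (where
`X_{12} ∼ X_4²` changes the shape) and `p = 5` (exceptional level `20`).  `HC_CM` is not touched.

## References

* [GalleseGoodsonLombardo2024] A. Gallese, H. Goodson, D. Lombardo, arXiv:2405.20394 — §3 Thm. 3.0 ((4), (5), last statement), §3.5
  Lemma 14 and the sentence following it.
* [MumfordAV1970] D. Mumford, *Abelian Varieties* — §19 Thm. 3 Cor. 1–2, p. 174.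
* [Shimura1998] G. Shimura — §5.1 Prop. 3, Prop. 6, §8.3 Prop. 28.
* [MilneCM2006] J. S. Milne, *Complex Multiplication* — Ch. I §3 Prop. 3.13.

## Provenance

Cell `pub-hodgecm2` (COR-CM), KEPT Literature lane `lit-deligne-3` gen 51 (claim GGL24-FOUR-TIMES-PRIME; count-neutral, own lane).
-/

noncomputable section

open CategoryTheory CategoryTheory.Limits NumberField Module

namespace Literature.AlgebraicGeometry.ComplexMultiplication

open Literature.AlgebraicGeometry.Motives
open Literature.AlgebraicGeometry.HodgeTheory (complexBetti)
open Literature.NumberTheory.ComplexMultiplication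

namespace HyperellipticJacobian

open Literature.AlgebraicGeometry.Pohlmann1968 Literature.AlgebraicGeometry.Pohlmann1968.Cyclotomic

/-! ## §1 `X_4 ⟂ Y_{d′}` for `φ(d′) ≠ 4`; in particular `X_4 ⟂ X_{4p}` for `p ≥ 7` -/

section FourVsFourDvd

variable {K₄ : Type} [Field K₄] [NumberField K₄] [IsCyclotomicExtension {4} ℚ K₄] {Φ₄ : CMType K₄}
  {A₄ : AbelianVariety ℂ} {ι₄ : 𝓞 K₄ →+* End A₄} {θ₄ : K₄ →+* Module.End ℂ (complexBetti A₄.X 1)}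
  {d' : ℕ} [NeZero d'] {K' : Type} [Field K'] [NumberField K'] [IsCyclotomicExtension {d'} ℚ K'] {Φ' : CMType K'}
  {A' : AbelianVariety ℂ} {ι' : 𝓞 K' →+* End A'} {θ' : K' →+* Module.End ℂ (complexBetti A'.X 1)}

/-- **`X_4 ⟂ Y_{d′}` whenever `φ(d′) ≠ 4`** (`4 ∣ d′ ≥ 8`, `d′ ∉ {20, 24, 60}`): the reflex degrees are `2` and `φ(d′)/2`.
[cite: GalleseGoodsonLombardo2024, §3 Thm. 3.0 (last statement)] [cite: MilneCM2006, Ch. I §3 Prop. 3.13] -/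
theorem orthogonal_four_fourDvd_of_totient_ne_four (hA₄ : IsCMTypeRealisation Φ₄ A₄ ι₄ θ₄) (h4 : 4 ∣ d') (h8 : 8 ≤ d')
    (h20 : d' ≠ 20) (h24 : d' ≠ 24) (h60 : d' ≠ 60) (hΦ' : ∀ σ : K' →+* ℂ, σ ∈ Φ'.1 ↔ 2 * (expOf d' K' σ).val < d')
    (hA' : IsCMTypeRealisation Φ' A' ι' θ') (hφ : Nat.totient d' ≠ 4) :
    (∀ u : A₄ ⟶ A', u = 0) ∧ (∀ v : A' ⟶ A₄, v = 0) ∧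
      ¬ AbelianVariety.IsIsogenous A₄ A' ∧ ¬ AbelianVariety.IsIsogenous A' A₄ := by
  refine hA₄.orthogonal_of_finrank_traceField_ne hA' fun h => hφ ?_
  rw [← two_mul_finrank_traceField_of_four_dvd h4 h8 h20 h24 h60 Φ' hΦ', ← h, finrank_traceField_four Φ₄]

end FourVsFourDvd

section FourTimesPrime

variable {p : ℕ} [NeZero p] [NeZero (2 * p)] [NeZero (4 * p)]
  {K₄ : Type} [Field K₄] [NumberField K₄] [IsCyclotomicExtension {4} ℚ K₄] {Φ₄ : CMType K₄}
  {A₄ : AbelianVariety ℂ} {ι₄ : 𝓞 K₄ →+* End A₄} {θ₄ : K₄ →+* Module.End ℂ (complexBetti A₄.X 1)}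
  {K : Type} [Field K] [NumberField K] [IsCyclotomicExtension {p} ℚ K] {Φ : CMType K}
  {A : AbelianVariety ℂ} {ι : 𝓞 K →+* End A} {θ : K →+* Module.End ℂ (complexBetti A.X 1)}
  {L : Type} [Field L] [NumberField L] [IsCyclotomicExtension {2 * p} ℚ L] {Ψ : CMType L}
  {A₂ : AbelianVariety ℂ} {ι₂ : 𝓞 L →+* End A₂} {θ₂ : L →+* Module.End ℂ (complexBetti A₂.X 1)}
  {K' : Type} [Field K'] [NumberField K'] [IsCyclotomicExtension {4 * p} ℚ K'] {Φ' : CMType K'}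
  {A' : AbelianVariety ℂ} {ι' : 𝓞 K' →+* End A'} {θ' : K' →+* Module.End ℂ (complexBetti A'.X 1)}

omit [NeZero p] [NeZero (2 * p)] [NeZero (4 * p)] in
/-- Arithmetic of the level `4p`, `p ≥ 7` prime: `φ(4p) = 2(p − 1)`, and `4p ∉ {20, 24, 60}`. [folklore] -/
private theorem totient_four_mul_prime (hp : p.Prime) (h7 : 7 ≤ p) :
    Nat.totient (4 * p) = 2 * (p - 1) ∧ 8 ≤ 4 * p ∧ 4 * p ≠ 20 ∧ 4 * p ≠ 24 ∧ 4 * p ≠ 60 := by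
  have hodd : Odd p := hp.odd_of_ne_two (by omega)
  have hcop : Nat.Coprime 4 p := by
    have h := (Nat.coprime_two_left.2 hodd).pow_left 2
    simpa using h
  have h15 : p ≠ 15 := by rintro rfl; exact absurd hp (by norm_num)
  refine ⟨?_, by omega, by omega, by omega, by omega⟩
  rw [Nat.totient_mul hcop, Nat.totient_prime hp, show Nat.totient 4 = 2 by decide +kernel]

omit [NeZero p] [NeZero (2 * p)] in
/-- **`X_4 ⟂ X_{4p}` for `p ≥ 7` prime** (reflex degrees `2 ≠ p − 1`): `Hom = 0` both ways, not isogenous, for every realisation of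
`Φ_4` and of `Φ_{4p}`. [cite: GalleseGoodsonLombardo2024, §3 Thm. 3.0 (last statement)] [cite: MilneCM2006, Ch. I §3 Prop. 3.13] -/
theorem orthogonal_four_fourTimesPrime (hp : p.Prime) (h7 : 7 ≤ p) (hA₄ : IsCMTypeRealisation Φ₄ A₄ ι₄ θ₄)
    (hΦ' : ∀ σ : K' →+* ℂ, σ ∈ Φ'.1 ↔ 2 * (expOf (4 * p) K' σ).val < 4 * p) (hA' : IsCMTypeRealisation Φ' A' ι' θ') :
    (∀ u : A₄ ⟶ A', u = 0) ∧ (∀ v : A' ⟶ A₄, v = 0) ∧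
      ¬ AbelianVariety.IsIsogenous A₄ A' ∧ ¬ AbelianVariety.IsIsogenous A' A₄ := by
  obtain ⟨hφ, h8, h20, h24, h60⟩ := totient_four_mul_prime hp h7
  exact orthogonal_four_fourDvd_of_totient_ne_four hA₄ (dvd_mul_right 4 p) h8 h20 h24 h60 hΦ' hA' (by omega)

/-! ## §2 The three blocks `A₄`, `A ⊕ A₂`, `A′` are pairwise orthogonal -/

/-- **The blocks `X_4`, `X_p ⊕ X_{2p}`, `X_{4p}` of `J_{4p}` (`p ≥ 7` prime) are pairwise orthogonal**: every homomorphism between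
two distinct members of the family `![A₄, A ⊕ A₂, A′]` vanishes (F12's orthogonality relations, assembled componentwise on the
biproduct). [cite: GalleseGoodsonLombardo2024, §3 Thm. 3.0 (last statement) and §3.5 (after Lemma 14)] [cite: MilneCM2006, Ch. I §3 Prop. 3.13] -/
theorem hom_eq_zero_blocks_fourTimesPrime (hp : p.Prime) (h7 : 7 ≤ p) (hA₄ : IsCMTypeRealisation Φ₄ A₄ ι₄ θ₄)
    (hΦ : ∀ σ : K →+* ℂ, σ ∈ Φ.1 ↔ 2 * (expOf p K σ).val < p) (hA : IsCMTypeRealisation Φ A ι θ)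
    (hΨ : ∀ σ : L →+* ℂ, σ ∈ Ψ.1 ↔ 2 * (expOf (2 * p) L σ).val < 2 * p) (hA₂ : IsCMTypeRealisation Ψ A₂ ι₂ θ₂)
    (hΦ' : ∀ σ : K' →+* ℂ, σ ∈ Φ'.1 ↔ 2 * (expOf (4 * p) K' σ).val < 4 * p) (hA' : IsCMTypeRealisation Φ' A' ι' θ') :
    ∀ i j : Fin 3, i ≠ j →
      ∀ f : (![A₄, ⨁ fun l : Fin 2 => (![A, A₂] : Fin 2 → AbelianVariety ℂ) l, A'] : Fin 3 → AbelianVariety ℂ) i ⟶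
        (![A₄, ⨁ fun l : Fin 2 => (![A, A₂] : Fin 2 → AbelianVariety ℂ) l, A'] : Fin 3 → AbelianVariety ℂ) j, f = 0 := by
  have hodd : Odd p := hp.odd_of_ne_two (by omega)
  have h3 : 3 ≤ p := by omega
  obtain ⟨-, h8, h20, h24, h60⟩ := totient_four_mul_prime hp h7
  have h4 : 4 ∣ 4 * p := dvd_mul_right 4 p
  -- the six elementary relations (F12 and §1)
  have oA₄A := orthogonal_odd_four (Φ' := Φ₄) hodd h3 hΦ hA hA₄
  have oA₄A₂ := orthogonal_twiceOdd_four (Φ' := Φ₄) hodd h3 hΨ hA₂ hA₄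
  have oA₄A' := orthogonal_four_fourTimesPrime hp h7 hA₄ hΦ' hA'
  have oAA' := orthogonal_odd_fourDvd hodd h3 hΦ hA h4 h8 h20 h24 h60 hΦ' hA'
  have oA₂A' := orthogonal_twiceOdd_fourDvd hodd h3 hΨ hA₂ h4 h8 h20 h24 h60 hΦ' hA'
  -- into / out of the middle block, componentwise
  have hinM : ∀ {Z : AbelianVariety ℂ}, (∀ u : Z ⟶ A, u = 0) → (∀ u : Z ⟶ A₂, u = 0) →
      ∀ f : Z ⟶ ⨁ fun l : Fin 2 => (![A, A₂] : Fin 2 → AbelianVariety ℂ) l, f = 0 := by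
    intro Z h0 h1 f
    refine biproduct.hom_ext _ _ fun l => ?_
    rw [zero_comp]
    match l with
    | ⟨0, _⟩ => exact h0 _
    | ⟨1, _⟩ => exact h1 _
  have houtM : ∀ {Z : AbelianVariety ℂ}, (∀ u : A ⟶ Z, u = 0) → (∀ u : A₂ ⟶ Z, u = 0) →
      ∀ f : (⨁ fun l : Fin 2 => (![A, A₂] : Fin 2 → AbelianVariety ℂ) l) ⟶ Z, f = 0 := by
    intro Z h0 h1 f
    refine biproduct.hom_ext' _ _ fun l => ?_
    rw [comp_zero]
    match l with
    | ⟨0, _⟩ => exact h0 _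
    | ⟨1, _⟩ => exact h1 _
  intro i j hij f
  match i, j with
  | ⟨0, _⟩, ⟨0, _⟩ => exact absurd rfl hij
  | ⟨1, _⟩, ⟨1, _⟩ => exact absurd rfl hij
  | ⟨2, _⟩, ⟨2, _⟩ => exact absurd rfl hij
  | ⟨0, _⟩, ⟨1, _⟩ => exact hinM oA₄A.2.1 oA₄A₂.2.1 f
  | ⟨1, _⟩, ⟨0, _⟩ => exact houtM oA₄A.1 oA₄A₂.1 f
  | ⟨0, _⟩, ⟨2, _⟩ => exact oA₄A'.1 f
  | ⟨2, _⟩, ⟨0, _⟩ => exact oA₄A'.2.1 f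
  | ⟨1, _⟩, ⟨2, _⟩ => exact houtM oAA'.1 oA₂A'.1 f
  | ⟨2, _⟩, ⟨1, _⟩ => exact hinM oAA'.2.1 oA₂A'.2.1 f

/-! ## §3 `End⁰(J_{4p}) ≅ ℚ(i) × Mat₂(ℚ(ζ_p)) × Mat₂(ℚ(ζ_{4p} − ζ_{4p}⁻¹))`, of dimension `8p − 6`; `dim J_{4p} = 2p − 1` -/

omit [IsCyclotomicExtension {4} ℚ K₄] in
/-- `[ℚ(ζ_4) : ℚ] = 2`. [folklore] -/
private theorem finrank_eq_two_four' [IsCyclotomicExtension {4} ℚ K₄] : finrank ℚ K₄ = 2 := by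
  haveI : NeZero (4 : ℕ) := ⟨by norm_num⟩
  rw [IsCyclotomicExtension.finrank (K := ℚ) (n := 4) K₄ (Polynomial.cyclotomic.irreducible_rat (by norm_num))]
  decide +kernel

/-- The product of three algebras indexed by `Fin 3` (bookkeeping: `∏_{i : Fin 3} T_i ≃ₐ T₀ × (T₁ × T₂)`). [folklore] -/
private theorem nonempty_pi_fin_three_algEquiv_prod (T : Fin 3 → Type) [∀ i, Ring (T i)] [∀ i, Algebra ℚ (T i)] :
    Nonempty ((∀ i, T i) ≃ₐ[ℚ] T 0 × (T 1 × T 2)) := by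
  refine ⟨AlgEquiv.ofBijective
    ((Pi.evalAlgHom ℚ T 0).prod ((Pi.evalAlgHom ℚ T 1).prod (Pi.evalAlgHom ℚ T 2))) ⟨fun f g h => ?_, fun x => ?_⟩⟩
  · simp only [AlgHom.prod_apply, Pi.evalAlgHom_apply, Prod.mk.injEq] at h
    funext i
    match i with
    | ⟨0, _⟩ => exact h.1
    | ⟨1, _⟩ => exact h.2.1
    | ⟨2, _⟩ => exact h.2.2
  · refine ⟨Fin.cons x.1 (Fin.cons x.2.1 (Fin.cons x.2.2 finZeroElim)), ?_⟩
    rfl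

/-- **GGL THM. 3.0 + LEMMA 14 at the level `4p`, `p ≥ 7` prime: `End⁰(J_{4p}) ≃ₐ[ℚ] ℚ(ζ_4) × (Mat₂(ℚ(ζ_p)) × Mat₂(ℚ(ζ_{4p} − ζ_{4p}⁻¹)))`**
— «this lemma, combined with the last statement in Thm. 3.0, yields the geometric endomorphism algebra of `J_m`» for `m = 4p`, on
the carrier `⨁_{Fin 3} ![A₄, A ⊕ A₂, A′]`: the blocks are pairwise orthogonal (§2), so `End⁰` is the product of the blocks' `End⁰`
(Mumford §19 Cor. 2, tree `AbelianVariety.nonempty_algEquiv_endAlgebra_biproduct_pi`); `End⁰(A₄) = ℚ(ζ_4)` (every type of `ℚ(i)` is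
primitive), `End⁰(A ⊕ A₂) ≅ End⁰(A²) ≅ Mat₂(ℚ(ζ_p))` (`A₂ ∼ A`, Thm. 3.0 (4); Lemma 14, first case), `End⁰(A′) ≅ Mat₂(ℚ(ζ_{4p} − ζ_{4p}⁻¹))`
(Lemma 14 (2)). [cite: GalleseGoodsonLombardo2024, §3.5 Lemma 14 and the sentence following it; §3 Thm. 3.0 (4), (5), last statement]
[cite: MumfordAV1970, §19 Cor. 2 of Thm. 3 and p. 174] [cite: Shimura1998, §5.1 Prop. 3 (proof) and Prop. 6] -/
theorem nonempty_endAlgebra_algEquiv_fourTimesPrime (hp : p.Prime) (h7 : 7 ≤ p) (hA₄ : IsCMTypeRealisation Φ₄ A₄ ι₄ θ₄)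
    (hΦ : ∀ σ : K →+* ℂ, σ ∈ Φ.1 ↔ 2 * (expOf p K σ).val < p) (hA : IsCMTypeRealisation Φ A ι θ)
    (hΨ : ∀ σ : L →+* ℂ, σ ∈ Ψ.1 ↔ 2 * (expOf (2 * p) L σ).val < 2 * p) (hA₂ : IsCMTypeRealisation Ψ A₂ ι₂ θ₂)
    (hΦ' : ∀ σ : K' →+* ℂ, σ ∈ Φ'.1 ↔ 2 * (expOf (4 * p) K' σ).val < 4 * p) (hA' : IsCMTypeRealisation Φ' A' ι' θ') :
    Nonempty ((⨁ fun i : Fin 3 =>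
        (![A₄, ⨁ fun l : Fin 2 => (![A, A₂] : Fin 2 → AbelianVariety ℂ) l, A'] : Fin 3 → AbelianVariety ℂ) i).endAlgebra ≃ₐ[ℚ]
      K₄ × (Matrix (Fin 2) (Fin 2) K ×
        Matrix (Fin 2) (Fin 2) (IntermediateField.adjoin ℚ {zetaOf (4 * p) K' - (zetaOf (4 * p) K')⁻¹}))) := by
  classical
  have hodd : Odd p := hp.odd_of_ne_two (by omega)
  have h3 : 3 ≤ p := by omega
  obtain ⟨-, h8, h20, h24, h60⟩ := totient_four_mul_prime hp h7
  -- `End⁰` of the orthogonal biproduct is the product of the blocks' `End⁰`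
  obtain ⟨E, -⟩ := AbelianVariety.nonempty_algEquiv_endAlgebra_biproduct_pi
    (A := fun i : Fin 3 => (![A₄, ⨁ fun l : Fin 2 => (![A, A₂] : Fin 2 → AbelianVariety ℂ) l, A'] : Fin 3 → AbelianVariety ℂ) i)
    (hom_eq_zero_blocks_fourTimesPrime hp h7 hA₄ hΦ hA hΨ hA₂ hΦ' hA')
  obtain ⟨P⟩ := nonempty_pi_fin_three_algEquiv_prod
    (fun i : Fin 3 => ((![A₄, ⨁ fun l : Fin 2 => (![A, A₂] : Fin 2 → AbelianVariety ℂ) l, A'] : Fin 3 → AbelianVariety ℂ) i).endAlgebra)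
  -- the three blocks
  obtain ⟨e₀⟩ : Nonempty (A₄.endAlgebra ≃ₐ[ℚ] K₄) :=
    hA₄.nonempty_endAlgebra_algEquiv_of_primitive (CMTypeLattice.primitive_of_finrank_eq_two Φ₄ finrank_eq_two_four')
  obtain ⟨e₁⟩ : Nonempty ((⨁ fun l : Fin 2 => (![A, A₂] : Fin 2 → AbelianVariety ℂ) l).endAlgebra ≃ₐ[ℚ]
      Matrix (Fin 2) (Fin 2) K) := by
    obtain ⟨f₁⟩ := (isIsogenous_biproduct_pair (isIsogenous_twiceOdd hodd h3 hΨ hΦ hA₂ hA)).nonempty_endAlgebra_algEquiv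
    obtain ⟨f₂⟩ := nonempty_matrix_algEquiv_endAlgebra_biproduct_const A 2
    obtain ⟨f₃⟩ := nonempty_endAlgebra_algEquiv_odd hodd Φ hΦ hA
    exact ⟨(f₁.trans f₂.symm).trans f₃.mapMatrix⟩
  obtain ⟨-, ⟨e₂⟩, -⟩ := nonempty_matrix_two_algEquiv_endAlgebra_of_four_dvd (dvd_mul_right 4 p) h8 h20 h24 h60 Φ' hΦ' hA'
  exact ⟨(E.trans P).trans (AlgEquiv.prodCongr e₀ (AlgEquiv.prodCongr e₁ e₂.symm))⟩

/-- **`dim_ℚ End⁰(J_{4p}) = 8p − 6` and `dim J_{4p} = 2p − 1 = g(C_{4p})`** (`p ≥ 7` prime; `2 + 4(p−1) + 4(p−1)`, resp.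
`1 + (p−1)/2·2 + (p−1)`). [cite: GalleseGoodsonLombardo2024, §3 Thm. 3.0 («dim X_d = φ(d)/2») and §3.5 Lemma 14] [cite: MumfordAV1970, §19 Cor. 2 of Thm. 3] -/
theorem finrank_endAlgebra_fourTimesPrime (hp : p.Prime) (h7 : 7 ≤ p) (hA₄ : IsCMTypeRealisation Φ₄ A₄ ι₄ θ₄)
    (hΦ : ∀ σ : K →+* ℂ, σ ∈ Φ.1 ↔ 2 * (expOf p K σ).val < p) (hA : IsCMTypeRealisation Φ A ι θ)
    (hΨ : ∀ σ : L →+* ℂ, σ ∈ Ψ.1 ↔ 2 * (expOf (2 * p) L σ).val < 2 * p) (hA₂ : IsCMTypeRealisation Ψ A₂ ι₂ θ₂)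
    (hΦ' : ∀ σ : K' →+* ℂ, σ ∈ Φ'.1 ↔ 2 * (expOf (4 * p) K' σ).val < 4 * p) (hA' : IsCMTypeRealisation Φ' A' ι' θ') :
    finrank ℚ (⨁ fun i : Fin 3 =>
        (![A₄, ⨁ fun l : Fin 2 => (![A, A₂] : Fin 2 → AbelianVariety ℂ) l, A'] : Fin 3 → AbelianVariety ℂ) i).endAlgebra =
      8 * p - 6 ∧
    (⨁ fun i : Fin 3 =>
        (![A₄, ⨁ fun l : Fin 2 => (![A, A₂] : Fin 2 → AbelianVariety ℂ) l, A'] : Fin 3 → AbelianVariety ℂ) i).dim = 2 * p - 1 := by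
  classical
  have hodd : Odd p := hp.odd_of_ne_two (by omega)
  obtain ⟨hφ, h8, h20, h24, h60⟩ := totient_four_mul_prime hp h7
  have h4 : 4 ∣ 4 * p := dvd_mul_right 4 p
  haveI : IsAbelianGalois ℚ K' := IsCyclotomicExtension.isAbelianGalois {4 * p} ℚ K'
  -- the degrees of the fields
  have hK : finrank ℚ K = p - 1 := by
    rw [IsCyclotomicExtension.finrank (K := ℚ) (n := p) K (Polynomial.cyclotomic.irreducible_rat (NeZero.pos p)),
      Nat.totient_prime hp]
  have hL : finrank ℚ L = p - 1 := by
    rw [IsCyclotomicExtension.finrank (K := ℚ) (n := 2 * p) L (Polynomial.cyclotomic.irreducible_rat (NeZero.pos (2 * p))),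
      Nat.totient_mul (Nat.coprime_two_left.2 hodd), Nat.totient_prime hp, Nat.totient_two, one_mul]
  have hK' : finrank ℚ K' = 2 * (p - 1) := by
    rw [IsCyclotomicExtension.finrank (K := ℚ) (n := 4 * p) K' (Polynomial.cyclotomic.irreducible_rat (NeZero.pos (4 * p))), hφ]
  have hF : finrank ℚ (IntermediateField.adjoin ℚ {zetaOf (4 * p) K' - (zetaOf (4 * p) K')⁻¹}) = p - 1 := by
    obtain ⟨K₁, Φ₁, h₁, hp₁, -⟩ := exists_primitive_inducedCMType_index_two_of_four_dvd h4 h8 h20 h24 h60 Φ' hΦ'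
    obtain ⟨-, -, -, -, -, -, -, hdeg, hK₁⟩ :=
      eq_fixedField_and_eq_adjoin_of_primitive_of_four_dvd h4 h8 h20 h24 h60 Φ' hΦ' Φ₁ h₁ hp₁
    rw [← hK₁]
    omega
  refine ⟨?_, ?_⟩
  · obtain ⟨e⟩ := nonempty_endAlgebra_algEquiv_fourTimesPrime hp h7 hA₄ hΦ hA hΨ hA₂ hΦ' hA'
    haveI : FiniteDimensional ℚ (IntermediateField.adjoin ℚ {zetaOf (4 * p) K' - (zetaOf (4 * p) K')⁻¹}) :=
      IntermediateField.finiteDimensional_left _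
    haveI : Module.Finite ℚ (Matrix (Fin 2) (Fin 2) (IntermediateField.adjoin ℚ {zetaOf (4 * p) K' - (zetaOf (4 * p) K')⁻¹})) :=
      Module.Finite.matrix
    haveI : Module.Finite ℚ (Matrix (Fin 2) (Fin 2) K) := Module.Finite.matrix
    rw [e.toLinearEquiv.finrank_eq, Module.finrank_prod, Module.finrank_prod, Module.finrank_matrix, Module.finrank_matrix,
      Fintype.card_fin, finrank_eq_two_four' (K₄ := K₄), hK, hF]
    omega
  · have hd₄ : A₄.dim = 1 := by
      have h : A₄.dim = finrank ℚ K₄ / 2 := Motives.schemeDim_eq_holds hA₄.1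
      rw [finrank_eq_two_four' (K₄ := K₄)] at h
      simpa using h
    have hd : 2 * A.dim = p - 1 := by
      have h : A.dim = finrank ℚ K / 2 := Motives.schemeDim_eq_holds hA.1
      have h2 := CMTypeLattice.two_mul_card_eq_finrank Φ
      rw [hK] at h h2; omega
    have hd₂ : 2 * A₂.dim = p - 1 := by
      have h : A₂.dim = finrank ℚ L / 2 := Motives.schemeDim_eq_holds hA₂.1
      have h2 := CMTypeLattice.two_mul_card_eq_finrank Ψ
      rw [hL] at h h2; omega
    have hd' : A'.dim = p - 1 := by
      have h : A'.dim = finrank ℚ K' / 2 := Motives.schemeDim_eq_holds hA'.1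
      rw [hK'] at h; omega
    rw [AbelianVariety.dim_biproduct, Fin.sum_univ_three]
    simp only [Matrix.cons_val_zero, Matrix.cons_val_one, Matrix.cons_val_two, Matrix.head_cons, Matrix.tail_cons]
    rw [AbelianVariety.dim_biproduct, Fin.sum_univ_two]
    simp only [Matrix.cons_val_zero, Matrix.cons_val_one]
    omega

end FourTimesPrime

end HyperellipticJacobian

end Literature.AlgebraicGeometry.ComplexMultiplication

end
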